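import Summits.KontsevichZagierPeriods.Zeta5Search.Barrier.ConeGammaCuspPeriodCanonical

/-!
# ζ(5) search — BARRIER: THE LEXICOGRAPHIC GERM OF THE CUSP SLOPE — one-sided directional derivatives of `σ` at EVERY
# displacement, generic or not, are canonical chamber functionals (file (1) of «THE LEXICOGRAPHIC GERM»)

HONEST FRAMING (cell `pub-zeta5`): systematic search; no irrationality claim unless kernel-certified. MODEL objects
under Brown–Zudilin's (28)+(30) accounting ([BZ22] = arXiv:2210.03391; (28) observed, not proved); nothing here is a
statement about `ζ(5)`, any `γ` of record, the cone's supremum (C2 OPEN) or the value / sign of the cusp slope, of a chamber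
weight or of a one-sided derivative at a named direction (DATA of the cell); NO cancellation is quantified; S-E / (TD_A) stay
CONJECTURED; records in print UNMOVED. Prover P2 g42 (item «THE LEXICOGRAPHIC GERM» = P2 g41's successor menu (b), file (1);
plan INBOX 2026-08-28). Sources: P2 g33 `ConeGammaCuspPeriodCanonical` (THE CHAMBER FORMULA: on the closed chamber of a generic
reference `δ₀`, `σ(δ') = Σ_k W_k(δ₀)·φ_k(δ')/h_k(a)` with the CANONICAL chamber weights `W_k(δ₀) = F(P≤(k)) − F(P<(k))`,
`F(A) = Σ_{m<#bkpts−1} patternN a b_m A`), P2 g30 `ConeGammaCuspChamberCover` (`exists_generic_refines`: the top chambers cover `ℝ⁸`).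

SETTING. `a` with all 28 forms positive, `T > 0` a period, `σ = cuspSlope a T`, rates `r_k(θ) = φ_k(θ)/h_k(a)`. At a
NON-generic displacement `δ` (some rates tie) `σ` need not be differentiable; along a segment `t ↦ δ + t·Δ` the ties of `δ`
are broken, for ALL small `t > 0`, by the rates of `Δ` — the chamber of `δ + t·Δ` is the LEXICOGRAPHIC chamber of the pair
`(δ, Δ)`: `r_k < r_l` there iff `r_k(δ) < r_l(δ)`, or `r_k(δ) = r_l(δ)` and `r_k(Δ) < r_l(Δ)`.
* `sign_window`, `exists_common_window` — finitely many affine functions of a small parameter `t > 0` have the lexicographic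
  sign pattern on a common window `(0, t₀]`; **`exists_lex_window`** — the chamber of `δ + t·Δ` is the lexicographic chamber
  for `0 < t ≤ t₀`; **`exists_generic_refines_lex`** — a generic `δ₀` refining the lexicographic order of `(δ, Δ)` exists (it
  refines `δ` and every `δ + t·Δ`, `0 < t ≤ t₀`);
* **`cuspSlope_add_smul_eq_of_lex` — THE LEXICOGRAPHIC GERM**: for EVERY `δ, Δ` and every generic `δ₀` refining their
  lexicographic order, **`σ(δ + t·Δ) = σ(δ) + t·Σ_k W_k(δ₀)·r_k(Δ)` for all `t ∈ [0, t₀]`** — `σ` is affine on the initial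
  segment, with slope the canonical chamber functional of the lexicographic chamber; **`hasDerivWithinAt_cuspSlope_of_lex`** —
  the one-sided directional derivative of `σ` at `δ` along `Δ` EXISTS and is that functional (at a generic `δ` this is P2 g33's
  chamber functional of `δ` for every `Δ`; at `δ = 0` it is `σ(Δ)` itself); `lex_functional_eq` — its value does not depend on
  the choice of `δ₀`;
* **`cuspSlope_symm_add_smul_eq_of_lex` — THE KINK OF `σ` AT `δ` ACROSS `Δ`**: with `δ₀⁺`, `δ₀⁻` refining the lexicographic
  orders of `(δ, Δ)` and `(δ, −Δ)`, **`σ(δ + t·Δ) + σ(δ − t·Δ) − 2σ(δ) = t·Σ_k (W_k(δ₀⁺) − W_k(δ₀⁻))·r_k(Δ)`** on `[0, t₀]` —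
  the symmetric second difference is LINEAR in `t`: the conical structure of `σ` at the origin (`σ(Δ) + σ(−Δ)`, the cusp) is
  reproduced at every displacement with ties, with the two lexicographic chambers in place of the top chambers of `±Δ`.
File (2) `ConeGammaCuspSlopeLexWall` reads the kink at a SIMPLE tie as the pooled wall defect of `F`; file (3)
`ConeGammaTranslateLexGerm` transfers both to the translate integral `P` on the coherence ball, at non-generic translates.
NOT here (honest): any value of a chamber weight, derivative or kink at a named direction (DATA); `Φ`, `γ`, C2, S-E's truth, `ζ(5)`.
-/

noncomputable section

open Set Finset Filter
open scoped Topology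

namespace Summit.KontsevichZagierPeriods.Zeta5Search.Barrier.ConeGamma

/-! ### Sign windows -/

/-- **Sign window of one affine function of the parameter.** For reals `p, q` there is `t₀ > 0` such that for
`0 < t ≤ t₀`: `0 < p + t·q ↔ (0 < p ∨ (p = 0 ∧ 0 < q))` — the LEXICOGRAPHIC sign of `(p, q)`. -/
theorem sign_window (p q : ℝ) :
    ∃ t₀ : ℝ, 0 < t₀ ∧ ∀ t : ℝ, 0 < t → t ≤ t₀ → (0 < p + t * q ↔ 0 < p ∨ (p = 0 ∧ 0 < q)) := by
  have hq1 : 0 < |q| + 1 := by positivity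
  have hqle : ∀ {t c : ℝ}, 0 < t → 0 ≤ c → t ≤ c / (2 * (|q| + 1)) → |t * q| ≤ c / 2 := by
    intro t c ht hc hle
    rw [abs_mul, abs_of_pos ht]
    have h1 : t * |q| ≤ c / (2 * (|q| + 1)) * |q| := mul_le_mul_of_nonneg_right hle (abs_nonneg q)
    have h2 : c / (2 * (|q| + 1)) * |q| ≤ c / 2 := by
      rw [div_mul_eq_mul_div, div_le_div_iff₀ (by positivity) two_pos]
      nlinarith [abs_nonneg q]
    exact h1.trans h2
  rcases lt_trichotomy p 0 with hp | hp | hp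
  · refine ⟨-p / (2 * (|q| + 1)), div_pos (by linarith) (by positivity), fun t ht hle => ?_⟩
    have h := (abs_le.mp (hqle ht (by linarith) hle)).2
    constructor
    · intro h'; linarith
    · rintro (h' | ⟨h', -⟩) <;> linarith
  · subst hp
    refine ⟨1, one_pos, fun t ht _ => ?_⟩
    rw [zero_add, mul_pos_iff_of_pos_left ht]
    simp
  · refine ⟨p / (2 * (|q| + 1)), div_pos hp (by positivity), fun t ht hle => ?_⟩
    have h := (abs_le.mp (hqle ht hp.le hle)).1
    exact ⟨fun _ => Or.inl hp, fun _ => by linarith⟩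

/-- **Finitely many windows have a common window.** -/
theorem exists_common_window {ι : Type*} (s : Finset ι) (P : ι → ℝ → Prop)
    (h : ∀ i ∈ s, ∃ t₀ : ℝ, 0 < t₀ ∧ ∀ t : ℝ, 0 < t → t ≤ t₀ → P i t) :
    ∃ t₀ : ℝ, 0 < t₀ ∧ ∀ t : ℝ, 0 < t → t ≤ t₀ → ∀ i ∈ s, P i t := by
  classical
  induction s using Finset.induction_on with
  | empty => exact ⟨1, one_pos, fun t _ _ i hi => absurd hi (Finset.notMem_empty _)⟩
  | insert j s hj ih =>
    obtain ⟨t₁, ht₁, h₁⟩ := ih fun i hi => h i (Finset.mem_insert_of_mem hi)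
    obtain ⟨t₂, ht₂, h₂⟩ := h j (Finset.mem_insert_self _ _)
    refine ⟨min t₁ t₂, lt_min ht₁ ht₂, fun t ht hle i hi => ?_⟩
    rcases Finset.mem_insert.mp hi with rfl | hi
    · exact h₂ t ht (hle.trans (min_le_right _ _))
    · exact h₁ t ht (hle.trans (min_le_left _ _)) i hi

/-! ### The lexicographic chamber of a pair of displacements -/

/-- Rates are affine along a segment: `r_k(δ + t·Δ) = r_k(δ) + t·r_k(Δ)`. -/
theorem rate_add_smul (a : Dir) (δ Δ : Fin 8 → ℝ) (t : ℝ) (k : Fin 28) :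
    phiForm (δ + t • Δ) k / h28 a k = phiForm δ k / h28 a k + t * (phiForm Δ k / h28 a k) := by
  rw [phiForm_add, phiForm_smul]; ring

/-- **THE LEXICOGRAPHIC WINDOW.** For displacements `δ, Δ` there is `t₀ > 0` such that for all `0 < t ≤ t₀` and all forms
`k, l`: `r_k(δ + t·Δ) < r_l(δ + t·Δ) ↔ (r_k(δ) < r_l(δ) ∨ (r_k(δ) = r_l(δ) ∧ r_k(Δ) < r_l(Δ)))` (`r_k = φ_k/h_k(a)`): for all
small `t > 0` the chamber of `δ + t·Δ` in the rate arrangement is ONE chamber, the LEXICOGRAPHIC chamber of the pair `(δ, Δ)`. -/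
theorem exists_lex_window (a : Dir) (δ Δ : Fin 8 → ℝ) :
    ∃ t₀ : ℝ, 0 < t₀ ∧ ∀ t : ℝ, 0 < t → t ≤ t₀ → ∀ k l : Fin 28,
      (phiForm (δ + t • Δ) k / h28 a k < phiForm (δ + t • Δ) l / h28 a l ↔
        (phiForm δ k / h28 a k < phiForm δ l / h28 a l ∨
          (phiForm δ k / h28 a k = phiForm δ l / h28 a l ∧ phiForm Δ k / h28 a k < phiForm Δ l / h28 a l))) := by
  obtain ⟨t₀, ht₀, h⟩ := exists_common_window (Finset.univ : Finset (Fin 28 × Fin 28))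
    (fun kl t => (phiForm (δ + t • Δ) kl.1 / h28 a kl.1 < phiForm (δ + t • Δ) kl.2 / h28 a kl.2 ↔
        (phiForm δ kl.1 / h28 a kl.1 < phiForm δ kl.2 / h28 a kl.2 ∨
          (phiForm δ kl.1 / h28 a kl.1 = phiForm δ kl.2 / h28 a kl.2 ∧
            phiForm Δ kl.1 / h28 a kl.1 < phiForm Δ kl.2 / h28 a kl.2))))
    (fun kl _ => by
      obtain ⟨t₀, ht₀, hw⟩ := sign_window (phiForm δ kl.2 / h28 a kl.2 - phiForm δ kl.1 / h28 a kl.1)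
        (phiForm Δ kl.2 / h28 a kl.2 - phiForm Δ kl.1 / h28 a kl.1)
      refine ⟨t₀, ht₀, fun t ht hle => ?_⟩
      have e : phiForm (δ + t • Δ) kl.2 / h28 a kl.2 - phiForm (δ + t • Δ) kl.1 / h28 a kl.1 =
          (phiForm δ kl.2 / h28 a kl.2 - phiForm δ kl.1 / h28 a kl.1) +
            t * (phiForm Δ kl.2 / h28 a kl.2 - phiForm Δ kl.1 / h28 a kl.1) := by
        rw [rate_add_smul, rate_add_smul]; ring
      have h1 : (phiForm (δ + t • Δ) kl.1 / h28 a kl.1 < phiForm (δ + t • Δ) kl.2 / h28 a kl.2) ↔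
          0 < (phiForm δ kl.2 / h28 a kl.2 - phiForm δ kl.1 / h28 a kl.1) +
            t * (phiForm Δ kl.2 / h28 a kl.2 - phiForm Δ kl.1 / h28 a kl.1) := by
        rw [← e, sub_pos]
      rw [h1, hw t ht hle, sub_pos, sub_eq_zero, sub_pos]
      exact or_congr Iff.rfl (and_congr eq_comm Iff.rfl))
  exact ⟨t₀, ht₀, fun t ht hle k l => h t ht hle (k, l) (Finset.mem_univ _)⟩

/-- **A GENERIC REFERENCE REFINING THE LEXICOGRAPHIC ORDER EXISTS.** For all 28 forms of `a` positive and every pair `(δ, Δ)`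
there is `δ₀` with pairwise distinct rates such that every lexicographic inequality of `(δ, Δ)` is a strict rate inequality
of `δ₀` (P2 g30's `exists_generic_refines` applied to `δ + t₀·Δ` inside the lexicographic window). Such a `δ₀` refines `δ`
(take the first alternative) and refines `δ + t·Δ` for every `0 < t ≤ t₀` (`exists_lex_window`). -/
theorem exists_generic_refines_lex {a : Dir} (hpos : ∀ k, 0 < h28 a k) (δ Δ : Fin 8 → ℝ) :
    ∃ δ₀ : Fin 8 → ℝ, (∀ k l : Fin 28, k ≠ l → phiForm δ₀ k / h28 a k ≠ phiForm δ₀ l / h28 a l) ∧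
      ∀ k l : Fin 28, (phiForm δ k / h28 a k < phiForm δ l / h28 a l ∨
          (phiForm δ k / h28 a k = phiForm δ l / h28 a l ∧ phiForm Δ k / h28 a k < phiForm Δ l / h28 a l)) →
        phiForm δ₀ k / h28 a k < phiForm δ₀ l / h28 a l := by
  obtain ⟨t₀, ht₀, hw⟩ := exists_lex_window a δ Δ
  obtain ⟨δ₀, hgen, href⟩ := exists_generic_refines hpos (δ + t₀ • Δ)
  exact ⟨δ₀, hgen, fun k l h => href k l ((hw t₀ ht₀ le_rfl k l).mpr h)⟩

/-! ### THE LEXICOGRAPHIC GERM of the cusp slope -/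

/-- **THE LEXICOGRAPHIC GERM OF `σ`.** All 28 forms of `a` positive, `T > 0` a period, `F` the canonical period pattern function
(`F(A) = Σ_{m<#bkpts−1} patternN a b_m A`). Let `δ, Δ` be ANY displacements and `δ₀` a generic reference (pairwise distinct
rates) refining the lexicographic order of `(δ, Δ)`. Then there is `t₀ > 0` with
**`cuspSlope a T (δ + t·Δ) = cuspSlope a T δ + t·Σ_k (F(P≤(k)) − F(P<(k)))·φ_k(Δ)/h_k(a)`** for all `t ∈ [0, t₀]`,
`P≤(k) = {l : r_k(δ₀) ≤ r_l(δ₀)}`, `P<(k) = {l : r_k(δ₀) < r_l(δ₀)}` — `σ` is AFFINE on the initial segment, its slope the canonical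
chamber functional of the lexicographic chamber (both `δ` and `δ + t·Δ` lie in the closed chamber of `δ₀`; P2 g33's chamber
formula at both). -/
theorem cuspSlope_add_smul_eq_of_lex {a : Dir} (hpos : ∀ k, 0 < h28 a k) {T : ℝ} (hT : 0 < T)
    (hper : ∀ k : Fin 28, ∃ z : ℤ, T * h28 a k = z) {F : Finset (Fin 28) → ℝ}
    (hF : ∀ A, F A = ∑ m ∈ Finset.range ((bkpts a T).card - 1), ((patternN a (bkpt a T m) A : ℤ) : ℝ))
    (δ Δ : Fin 8 → ℝ) {δ₀ : Fin 8 → ℝ}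
    (hgen : ∀ k l : Fin 28, k ≠ l → phiForm δ₀ k / h28 a k ≠ phiForm δ₀ l / h28 a l)
    (hlex : ∀ k l : Fin 28, (phiForm δ k / h28 a k < phiForm δ l / h28 a l ∨
        (phiForm δ k / h28 a k = phiForm δ l / h28 a l ∧ phiForm Δ k / h28 a k < phiForm Δ l / h28 a l)) →
      phiForm δ₀ k / h28 a k < phiForm δ₀ l / h28 a l) :
    ∃ t₀ : ℝ, 0 < t₀ ∧ ∀ t ∈ Icc (0 : ℝ) t₀,
      cuspSlope a T (δ + t • Δ) = cuspSlope a T δ +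
        t * ∑ k, (F (Finset.univ.filter fun l => phiForm δ₀ k / h28 a k ≤ phiForm δ₀ l / h28 a l) -
            F (Finset.univ.filter fun l => phiForm δ₀ k / h28 a k < phiForm δ₀ l / h28 a l)) *
          (phiForm Δ k / h28 a k) := by
  obtain ⟨t₀, ht₀, hw⟩ := exists_lex_window a δ Δ
  refine ⟨t₀, ht₀, fun t ht => ?_⟩
  have hδ : ∀ k l : Fin 28, phiForm δ k / h28 a k < phiForm δ l / h28 a l →
      phiForm δ₀ k / h28 a k < phiForm δ₀ l / h28 a l := fun k l h => hlex k l (Or.inl h)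
  rcases ht.1.eq_or_lt with h0 | ht0
  · subst h0; simp
  have hδt : ∀ k l : Fin 28, phiForm (δ + t • Δ) k / h28 a k < phiForm (δ + t • Δ) l / h28 a l →
      phiForm δ₀ k / h28 a k < phiForm δ₀ l / h28 a l := fun k l h => hlex k l ((hw t ht0 ht.2 k l).mp h)
  rw [cuspSlope_eq_greedy_canonical_of_refines hpos hT hper hF hgen _ hδt,
    cuspSlope_eq_greedy_canonical_of_refines hpos hT hper hF hgen _ hδ, Finset.mul_sum, ← Finset.sum_add_distrib]
  refine Finset.sum_congr rfl fun k _ => ?_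
  rw [rate_add_smul]; ring

/-- **THE ONE-SIDED DIRECTIONAL DERIVATIVE OF `σ` EXISTS AT EVERY DISPLACEMENT, ALONG EVERY DIRECTION, AND IS A CANONICAL
CHAMBER FUNCTIONAL**: under the hypotheses of `cuspSlope_add_smul_eq_of_lex`, `t ↦ cuspSlope a T (δ + t·Δ)` has right derivative
`Σ_k W_k(δ₀)·φ_k(Δ)/h_k(a)` at `t = 0` within `[0, ∞)`, `δ₀` any generic reference refining the lexicographic order of `(δ, Δ)`. -/
theorem hasDerivWithinAt_cuspSlope_of_lex {a : Dir} (hpos : ∀ k, 0 < h28 a k) {T : ℝ} (hT : 0 < T)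
    (hper : ∀ k : Fin 28, ∃ z : ℤ, T * h28 a k = z) {F : Finset (Fin 28) → ℝ}
    (hF : ∀ A, F A = ∑ m ∈ Finset.range ((bkpts a T).card - 1), ((patternN a (bkpt a T m) A : ℤ) : ℝ))
    (δ Δ : Fin 8 → ℝ) {δ₀ : Fin 8 → ℝ}
    (hgen : ∀ k l : Fin 28, k ≠ l → phiForm δ₀ k / h28 a k ≠ phiForm δ₀ l / h28 a l)
    (hlex : ∀ k l : Fin 28, (phiForm δ k / h28 a k < phiForm δ l / h28 a l ∨
        (phiForm δ k / h28 a k = phiForm δ l / h28 a l ∧ phiForm Δ k / h28 a k < phiForm Δ l / h28 a l)) →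
      phiForm δ₀ k / h28 a k < phiForm δ₀ l / h28 a l) :
    HasDerivWithinAt (fun t : ℝ => cuspSlope a T (δ + t • Δ))
      (∑ k, (F (Finset.univ.filter fun l => phiForm δ₀ k / h28 a k ≤ phiForm δ₀ l / h28 a l) -
            F (Finset.univ.filter fun l => phiForm δ₀ k / h28 a k < phiForm δ₀ l / h28 a l)) *
          (phiForm Δ k / h28 a k)) (Ici 0) 0 := by
  obtain ⟨t₀, ht₀, h⟩ := cuspSlope_add_smul_eq_of_lex hpos hT hper hF δ Δ hgen hlex
  obtain ⟨L, hL⟩ : ∃ L : ℝ, L = ∑ k, (F (Finset.univ.filter fun l => phiForm δ₀ k / h28 a k ≤ phiForm δ₀ l / h28 a l) -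
      F (Finset.univ.filter fun l => phiForm δ₀ k / h28 a k < phiForm δ₀ l / h28 a l)) * (phiForm Δ k / h28 a k) :=
    ⟨_, rfl⟩
  rw [← hL] at h ⊢
  have haff : HasDerivWithinAt (fun t : ℝ => cuspSlope a T δ + t * L) L (Ici 0) 0 := by
    have h1 := ((hasDerivAt_id (0 : ℝ)).mul_const L).const_add (cuspSlope a T δ)
    rw [one_mul] at h1
    exact h1.hasDerivWithinAt
  refine haff.congr_of_eventuallyEq ?_ (by simp)
  filter_upwards [Icc_mem_nhdsGE ht₀] with t ht
  exact h t ht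

/-- **The germ does not depend on the reference**: two generic references refining the lexicographic order of `(δ, Δ)` have
the same chamber functional value at `Δ` (both equal the slope of `σ` on the initial segment). -/
theorem lex_functional_eq {a : Dir} (hpos : ∀ k, 0 < h28 a k) {T : ℝ} (hT : 0 < T)
    (hper : ∀ k : Fin 28, ∃ z : ℤ, T * h28 a k = z) {F : Finset (Fin 28) → ℝ}
    (hF : ∀ A, F A = ∑ m ∈ Finset.range ((bkpts a T).card - 1), ((patternN a (bkpt a T m) A : ℤ) : ℝ))
    (δ Δ : Fin 8 → ℝ) {δ₀ δ₀' : Fin 8 → ℝ}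
    (hgen : ∀ k l : Fin 28, k ≠ l → phiForm δ₀ k / h28 a k ≠ phiForm δ₀ l / h28 a l)
    (hgen' : ∀ k l : Fin 28, k ≠ l → phiForm δ₀' k / h28 a k ≠ phiForm δ₀' l / h28 a l)
    (hlex : ∀ k l : Fin 28, (phiForm δ k / h28 a k < phiForm δ l / h28 a l ∨
        (phiForm δ k / h28 a k = phiForm δ l / h28 a l ∧ phiForm Δ k / h28 a k < phiForm Δ l / h28 a l)) →
      phiForm δ₀ k / h28 a k < phiForm δ₀ l / h28 a l)
    (hlex' : ∀ k l : Fin 28, (phiForm δ k / h28 a k < phiForm δ l / h28 a l ∨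
        (phiForm δ k / h28 a k = phiForm δ l / h28 a l ∧ phiForm Δ k / h28 a k < phiForm Δ l / h28 a l)) →
      phiForm δ₀' k / h28 a k < phiForm δ₀' l / h28 a l) :
    ∑ k, (F (Finset.univ.filter fun l => phiForm δ₀ k / h28 a k ≤ phiForm δ₀ l / h28 a l) -
          F (Finset.univ.filter fun l => phiForm δ₀ k / h28 a k < phiForm δ₀ l / h28 a l)) * (phiForm Δ k / h28 a k) =
      ∑ k, (F (Finset.univ.filter fun l => phiForm δ₀' k / h28 a k ≤ phiForm δ₀' l / h28 a l) -
          F (Finset.univ.filter fun l => phiForm δ₀' k / h28 a k < phiForm δ₀' l / h28 a l)) * (phiForm Δ k / h28 a k) := by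
  obtain ⟨t₁, ht₁, h₁⟩ := cuspSlope_add_smul_eq_of_lex hpos hT hper hF δ Δ hgen hlex
  obtain ⟨t₂, ht₂, h₂⟩ := cuspSlope_add_smul_eq_of_lex hpos hT hper hF δ Δ hgen' hlex'
  have hm := lt_min ht₁ ht₂
  have e1 := h₁ (min t₁ t₂) ⟨hm.le, min_le_left _ _⟩
  have e2 := h₂ (min t₁ t₂) ⟨hm.le, min_le_right _ _⟩
  rw [e1] at e2
  exact mul_left_cancel₀ hm.ne' (add_left_cancel e2)

/-! ### THE KINK of the cusp slope at a displacement with ties -/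

/-- Bookkeeping for the symmetric second difference. -/
theorem symm_second_difference_aux (σ t : ℝ) (W W' x : Fin 28 → ℝ) :
    σ + t * ∑ k, W k * x k + (σ + t * ∑ k, W' k * -x k) - 2 * σ = t * ∑ k, (W k - W' k) * x k := by
  simp only [mul_neg, Finset.sum_neg_distrib, sub_mul, Finset.sum_sub_distrib]
  ring

/-- **THE KINK OF `σ` AT `δ` ACROSS `Δ`.** All 28 forms of `a` positive, `T > 0` a period, `F` the canonical period pattern
function; `δ, Δ` ANY displacements; `δ₀` a generic reference refining the lexicographic order of `(δ, Δ)` and `δ₀'` one refining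
that of `(δ, −Δ)` (ties of `δ` broken by the REVERSED order of the rates of `Δ`). Then there is `t₀ > 0` with
**`σ(δ + t·Δ) + σ(δ − t·Δ) − 2σ(δ) = t·Σ_k (W_k(δ₀) − W_k(δ₀'))·φ_k(Δ)/h_k(a)` for all `t ∈ [0, t₀]`** — the symmetric second
difference of `σ` at `δ` is LINEAR in `t`: zero slope iff `Δ` crosses no kink of `σ` at `δ`; at `δ = 0` this is the cusp
`σ(t·Δ) + σ(−t·Δ) = t·(σ(Δ) + σ(−Δ))`. -/
theorem cuspSlope_symm_add_smul_eq_of_lex {a : Dir} (hpos : ∀ k, 0 < h28 a k) {T : ℝ} (hT : 0 < T)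
    (hper : ∀ k : Fin 28, ∃ z : ℤ, T * h28 a k = z) {F : Finset (Fin 28) → ℝ}
    (hF : ∀ A, F A = ∑ m ∈ Finset.range ((bkpts a T).card - 1), ((patternN a (bkpt a T m) A : ℤ) : ℝ))
    (δ Δ : Fin 8 → ℝ) {δ₀ δ₀' : Fin 8 → ℝ}
    (hgen : ∀ k l : Fin 28, k ≠ l → phiForm δ₀ k / h28 a k ≠ phiForm δ₀ l / h28 a l)
    (hgen' : ∀ k l : Fin 28, k ≠ l → phiForm δ₀' k / h28 a k ≠ phiForm δ₀' l / h28 a l)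
    (hlex : ∀ k l : Fin 28, (phiForm δ k / h28 a k < phiForm δ l / h28 a l ∨
        (phiForm δ k / h28 a k = phiForm δ l / h28 a l ∧ phiForm Δ k / h28 a k < phiForm Δ l / h28 a l)) →
      phiForm δ₀ k / h28 a k < phiForm δ₀ l / h28 a l)
    (hlex' : ∀ k l : Fin 28, (phiForm δ k / h28 a k < phiForm δ l / h28 a l ∨
        (phiForm δ k / h28 a k = phiForm δ l / h28 a l ∧ phiForm Δ l / h28 a l < phiForm Δ k / h28 a k)) →
      phiForm δ₀' k / h28 a k < phiForm δ₀' l / h28 a l) :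
    ∃ t₀ : ℝ, 0 < t₀ ∧ ∀ t ∈ Icc (0 : ℝ) t₀,
      cuspSlope a T (δ + t • Δ) + cuspSlope a T (δ - t • Δ) - 2 * cuspSlope a T δ =
        t * ∑ k, ((F (Finset.univ.filter fun l => phiForm δ₀ k / h28 a k ≤ phiForm δ₀ l / h28 a l) -
            F (Finset.univ.filter fun l => phiForm δ₀ k / h28 a k < phiForm δ₀ l / h28 a l)) -
          (F (Finset.univ.filter fun l => phiForm δ₀' k / h28 a k ≤ phiForm δ₀' l / h28 a l) -
            F (Finset.univ.filter fun l => phiForm δ₀' k / h28 a k < phiForm δ₀' l / h28 a l))) *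
          (phiForm Δ k / h28 a k) := by
  have hneg : ∀ k, phiForm (-Δ) k / h28 a k = -(phiForm Δ k / h28 a k) := fun k => by
    rw [phiForm_neg, neg_div]
  have hlex'' : ∀ k l : Fin 28, (phiForm δ k / h28 a k < phiForm δ l / h28 a l ∨
      (phiForm δ k / h28 a k = phiForm δ l / h28 a l ∧ phiForm (-Δ) k / h28 a k < phiForm (-Δ) l / h28 a l)) →
        phiForm δ₀' k / h28 a k < phiForm δ₀' l / h28 a l := by
    intro k l h
    refine hlex' k l (h.imp_right fun h' => ⟨h'.1, ?_⟩)
    have h2 := h'.2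
    rw [hneg, hneg, neg_lt_neg_iff] at h2
    exact h2
  obtain ⟨t₁, ht₁, h₁⟩ := cuspSlope_add_smul_eq_of_lex hpos hT hper hF δ Δ hgen hlex
  obtain ⟨t₂, ht₂, h₂⟩ := cuspSlope_add_smul_eq_of_lex hpos hT hper hF δ (-Δ) hgen' hlex''
  refine ⟨min t₁ t₂, lt_min ht₁ ht₂, fun t ht => ?_⟩
  have e1 := h₁ t ⟨ht.1, ht.2.trans (min_le_left _ _)⟩
  have e2 := h₂ t ⟨ht.1, ht.2.trans (min_le_right _ _)⟩
  rw [smul_neg, ← sub_eq_add_neg] at e2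
  simp only [hneg] at e2
  rw [e1, e2]
  exact symm_second_difference_aux _ _ _ _ _

/-- **THE KINK OF `σ`, reference-free existence form**: for EVERY `δ, Δ` the symmetric second difference of `σ` at `δ` along `Δ`
is `t·κ` on an initial segment `[0, t₀]`, for a constant `κ` which is a difference of two canonical chamber functionals at `Δ`
(the two lexicographic references exist by `exists_generic_refines_lex`). -/
theorem exists_cuspSlope_symm_add_smul_eq {a : Dir} (hpos : ∀ k, 0 < h28 a k) {T : ℝ} (hT : 0 < T)
    (hper : ∀ k : Fin 28, ∃ z : ℤ, T * h28 a k = z) {F : Finset (Fin 28) → ℝ}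
    (hF : ∀ A, F A = ∑ m ∈ Finset.range ((bkpts a T).card - 1), ((patternN a (bkpt a T m) A : ℤ) : ℝ))
    (δ Δ : Fin 8 → ℝ) :
    ∃ δ₀ δ₀' : Fin 8 → ℝ, (∀ k l : Fin 28, k ≠ l → phiForm δ₀ k / h28 a k ≠ phiForm δ₀ l / h28 a l) ∧
      (∀ k l : Fin 28, k ≠ l → phiForm δ₀' k / h28 a k ≠ phiForm δ₀' l / h28 a l) ∧
      (∀ k l : Fin 28, phiForm δ k / h28 a k < phiForm δ l / h28 a l →
        phiForm δ₀ k / h28 a k < phiForm δ₀ l / h28 a l ∧ phiForm δ₀' k / h28 a k < phiForm δ₀' l / h28 a l) ∧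
      ∃ t₀ : ℝ, 0 < t₀ ∧ ∀ t ∈ Icc (0 : ℝ) t₀,
        cuspSlope a T (δ + t • Δ) + cuspSlope a T (δ - t • Δ) - 2 * cuspSlope a T δ =
          t * ∑ k, ((F (Finset.univ.filter fun l => phiForm δ₀ k / h28 a k ≤ phiForm δ₀ l / h28 a l) -
              F (Finset.univ.filter fun l => phiForm δ₀ k / h28 a k < phiForm δ₀ l / h28 a l)) -
            (F (Finset.univ.filter fun l => phiForm δ₀' k / h28 a k ≤ phiForm δ₀' l / h28 a l) -
              F (Finset.univ.filter fun l => phiForm δ₀' k / h28 a k < phiForm δ₀' l / h28 a l))) *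
            (phiForm Δ k / h28 a k) := by
  obtain ⟨δ₀, hgen, hlex⟩ := exists_generic_refines_lex hpos δ Δ
  obtain ⟨δ₀', hgen', hlex₀⟩ := exists_generic_refines_lex hpos δ (-Δ)
  have hneg : ∀ k, phiForm (-Δ) k / h28 a k = -(phiForm Δ k / h28 a k) := fun k => by
    rw [phiForm_neg, neg_div]
  have hlex' : ∀ k l : Fin 28, (phiForm δ k / h28 a k < phiForm δ l / h28 a l ∨
      (phiForm δ k / h28 a k = phiForm δ l / h28 a l ∧ phiForm Δ l / h28 a l < phiForm Δ k / h28 a k)) →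
        phiForm δ₀' k / h28 a k < phiForm δ₀' l / h28 a l := by
    intro k l h
    refine hlex₀ k l (h.imp_right fun h' => ⟨h'.1, ?_⟩)
    rw [hneg, hneg, neg_lt_neg_iff]
    exact h'.2
  obtain ⟨t₀, ht₀, h⟩ := cuspSlope_symm_add_smul_eq_of_lex hpos hT hper hF δ Δ hgen hgen' hlex hlex'
  exact ⟨δ₀, δ₀', hgen, hgen', fun k l hkl => ⟨hlex k l (Or.inl hkl), hlex' k l (Or.inl hkl)⟩, t₀, ht₀, h⟩

end Summit.KontsevichZagierPeriods.Zeta5Search.Barrier.ConeGamma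

end
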